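import Literature.AlgebraicGeometry.Frobenioids.ArchimedeanCharSplitting
import Literature.AlgebraicGeometry.Frobenioids.ArchimedeanFrobeniusTrivial
import HarnessLib

/-!
# Frobenioids II, Theorem 3.6 (i): the radial elements of `O^▷(A)` — kernel witnesses for the
# FACT-LIST row F-2634 `ArchFrd.radialO`

Mochizuki, *The geometry of Frobenioids II: poly-Frobenioids*, Kyushu J. Math. **62** (2008)
401–460, §3, Theorem 3.6 (i) p. 36 [cite: MochizukiFrdII2008, Thm 3.6 (i) p.36]: "the canonical
decomposition of Definition 3.1, (ii), determines a characteristic splitting [cf. [Mzk5],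
Definition 2.3] on `C^Λ`"; Definition 3.1 (ii) p. 23: the canonical decomposition
`O_K^× × ord(K^×) ⥲ K^×`, `ord(K^×) ≅ ℝ_{>0}`.

PROOF-ONLY companion of `ArchimedeanCharSplitting.lean` (statement owner abc-iut-L1-t9); nothing is
defined here, no statement of the paper is retyped or strengthened. abc-iut cell, block F
(fact-proving wave), seat f-009, tranche 9 of `plan/F-TRANCHES.tsv`.

The row F-2634 names `ArchFrd.radialO π A t` — the DEFINITION of the submonoid `τ(A) ⊆ O^▷(A)` of
radial elements (base-identity linear endomorphisms of `A ∈ Ob(C)` with positive real scalar, the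
factor `ord(K^×)` of the canonical decomposition), i.e. VOCABULARY (a predicate of an endomorphism
`t`), not a claim of print; `kernel_closedness = parametrised`. What the kernel can say about it is
recorded here:
* the CLOSED FORM `radialO_iff`: `t ∈ τ(A)` iff `t` is the radial endomorphism `ρ_r = ((id, 1, r), id)`
  of some `0 < r ≤ 1` (abc-iut-L1-t9's `eq_radialEndC` / `radialEndC_mem`; `r ≤ 1` because a linear
  endomorphism rescales the angular region into itself, `absHom_scalar_le_one`) — so the predicate is
  decided by the tree, and its positive instance form `radialEndC_mem` is the only one there is;
* `τ(A)` contains the identity and is closed under composition (`radialO_id`, `radialO_comp`: the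
  submonoid `radialSubmonoid` of abc-iut-L1-t9, restated for arrows);
* the universal closure "every endomorphism of every object of `C` is radial" is FALSE
  (`not_forall_radialO`): over the printed base `D := D₀`, `π := 𝟭 D₀`, the degree-`2` Frobenius
  endomorphism `ζ₂ = ((id, 2, t^{-1}), id)` of the real unit `((Spec ℝ, [0, 1]), Spec ℝ)` (Ex. 3.3 (ii),
  `C.frobEndo`) is not linear, hence not in `O^▷`, hence not radial (`not_radialO_frobEndo`) — R5 /
  STRIKE trigger for the row's universal reading; the row's content as vocabulary is untouched.

typed ≠ proved for anything not in this file; a FACT row is an assumption label, not an endorsement;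
nothing here bears on [IUTchIII] Cor. 3.12.
-/

namespace Literature.AlgebraicGeometry.Frobenioids

open CategoryTheory

noncomputable section

namespace ArchFrd

universe v u

variable {D : Type u} [Category.{v} D] (π : D ⥤ D0)

/-! ### The closed form of `τ(A)` -/

/-- **`τ(A)` in closed form**: an endomorphism `t` of `A ∈ Ob(C)` is a radial element of `O^▷(A)` iff
it is the radial endomorphism `ρ_r = ((id, 1, r), id)` for some real `0 < r ≤ 1` (its scalar).
[cite: MochizukiFrdII2008, Thm 3.6 (i) p.36] -/
theorem radialO_iff (A : C π) (t : A ⟶ A) :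
    radialO π A t ↔ ∃ (r : PosReal) (hr : r ≤ 1), t = radialEndC π A r hr :=
  ⟨fun ht => ⟨radialScalar π ht, radialScalar_le_one π ht, eq_radialEndC π ht⟩,
    fun ⟨r, hr, h⟩ => h ▸ radialEndC_mem π A r hr⟩

/-- The identity is a radial element of `O^▷(A)` (scalar `1`). [cite: MochizukiFrdII2008, Thm 3.6 (i) p.36] -/
theorem radialO_id (A : C π) : radialO π A (𝟙 A) := (radialSubmonoid π A).one_mem

/-- Radial elements are closed under composition (scalars multiply; base-identity endomorphisms do not
twist scalars). [cite: MochizukiFrdII2008, Thm 3.6 (i) p.36] -/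
theorem radialO_comp {A : C π} {s t : A ⟶ A} (hs : radialO π A s) (ht : radialO π A t) :
    radialO π A (s ≫ t) :=
  (radialSubmonoid π A).mul_mem (x := (t : End A)) (y := (s : End A)) ht hs

/-- A radial element has a radial scalar: real part positive, imaginary part zero.
[cite: MochizukiFrdII2008, Def 3.1 (ii) p.23] -/
theorem radial_of_radialO {A : C π} {t : A ⟶ A} (ht : radialO π A t) : radial π A t := ht.2

/-- A radial element lies in `O^▷(A)`: it is base-identity (`D`-component the identity) and linear
(Frobenius degree `1`). [cite: MochizukiFrdII2008, Thm 3.6 (i) p.36] -/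
theorem snd_eq_id_and_degFr_eq_one_of_radialO {A : C π} {t : A ⟶ A} (ht : radialO π A t) :
    t.snd = 𝟙 A.snd ∧ C0.degFr t.fst = 1 :=
  ⟨ht.1.1, ht.1.2⟩

/-! ### F-2634: the universal closure is false -/

/-- The Frobenius endomorphism `ζ_n` (`n ≠ 1`) of an object of `C` with naively isotropic region is NOT
a radial element of `O^▷(A)`: its Frobenius degree is `n ≠ 1`, so it is not linear.
[cite: MochizukiFrdII2008, Ex 3.3 (ii) p.28] -/
theorem not_radialO_frobEndo (X : C π) (hX : X.fst.IsNaivelyIsotropic) (n : ℕ+) (hn : n ≠ 1) :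
    ¬ radialO π X (C.frobEndo X hX n) :=
  fun h => hn (snd_eq_id_and_degFr_eq_one_of_radialO π h).2

/-- **FACT-LIST F-2634**: the universal closure of `ArchFrd.radialO` — "every endomorphism of every
object of `C = C₀ ×_{D₀} D`, over every base, is a radial element of `O^▷`" — is FALSE: over the
printed base `D := D₀`, `π := 𝟭 D₀`, the degree-`2` Frobenius endomorphism of the real unit
`((Spec ℝ, [0, 1]), Spec ℝ)` is not radial. (`radialO` is the definition of `τ(A)`, vocabulary; its
closed form is `radialO_iff`.) [cite: MochizukiFrdII2008, Thm 3.6 (i) p.36] -/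
theorem not_forall_radialO :
    ¬ ∀ {D : Type} [Category.{0} D] (π : D ⥤ D0) (A : C π) (t : A ⟶ A),
      Literature.AlgebraicGeometry.Frobenioids.ArchFrd.radialO π A t := by
  intro h
  let X : C (𝟭 D0) := ⟨C0.realOfTip 1, D0.real, Iso.refl _⟩
  have hX : X.fst.IsNaivelyIsotropic := C0.isNaivelyIsotropic_of_isRealObj rfl
  exact not_radialO_frobEndo (𝟭 D0) X hX 2 (by decide) (h (𝟭 D0) X _)

end ArchFrd

end

end Literature.AlgebraicGeometry.Frobenioids
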